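import Mathlib
import HarnessLib
import Summits.HubbardSuperconductivity.HubbardSuperconductivity.Theorems.KLProgrammeKLRegimeTwoVolumeDualReadoutRows

/-!
# The two-CUTOFF common-point defect of the scale-`n` readings from the dual-lattice two-leg rows — the (D) input of row C1 (`hcut`)
# (β′ lane, read-out half; cell gate-hubbard-kl, seat hubbard-kl-k3c5-p2 g7)

Twin of `…TwoVolumeDualReadout(Rows)` for the CUTOFF leg: ONE spatial torus `L`, two Matsubara cutoffs `M₁`, `M₂`, two frames `K₁`, `K₂`.  r2d-p1's
`cutLeg_step_of_pointDefect_hist` (…EngineTwoLegCutLegStepSplit) asks for the common-point defect `|S₁(q) − S₂(q)|`,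
`S_i = symInterp L (klLocSelfEnergyRe L M_i … K_i n)`.  Both interpolants live on the SAME torus, so no lift and no far tails occur:
`|I_L[f₁](q) − I_L[f₂](q)| ≤ Σ_y |c₁(y) − c₂(y)|` (`abs_symInterp_eval_le`), and by `torusCosCoeff_re_selfEnergy_eq_row_of_rowInvariant` each
coefficient is `ε_i·Re[R_i(o_i; y) + R_i(o_i; −y)]` with the phase-weighted dual row `R_i` of the volume `(L, M_i)` at its kept frequency — so

* §1 (generic `G₁ : HubbardGrassmann L M₁`, `G₂ : HubbardGrassmann L M₂`, row-invariant): `|I_L[Re Σ_{G₁}((ω₁,·),σ)](q) − I_L[Re Σ_{G₂}((ω₂,·),σ)](q)|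
  ≤ Σ_y (‖ε₁R₁(o₁;y) − ε₂R₂(o₂;y)‖ + ‖ε₁R₁(o₁;−y) − ε₂R₂(o₂;−y)‖)` at any pins (`abs_eval_symInterp_re_selfEnergy_sub_le_dualCutDefect`);
* §2 (model, `G_i = 𝒱_{L,M_i}⁽ⁿ⁾[K_i] − 𝒩_{K_i}`, rows base-point free by `rows_baseIndependent_klEffectiveAction_sub_counter`, frames of degree `≤ L/2`):
  **`abs_symInterp_locRe_sub_le_frame_add_dualCutDefect`** — `|S₁(q) − S₂(q)| ≤ |K₁(q) − K₂(q)| + D` whenever each of the four string pairs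
  (`ω₀^{(M₁)} ↔ ω₀^{(M₂)}`, `−ω₀^{(M₁)} ↔ −ω₀^{(M₂)}`; `σ`) has `Σ_y (‖ε₁R₁ − ε₂R₂‖(y) + ‖ε₁R₁ − ε₂R₂‖(−y)) ≤ D`.

Remark (`row_eq_of_diagonal`): `ε_i·R_i(o; y) = β·Σ_{k⃗} kernel G_i 2 (((ω₀^{(M_i)},k⃗),σ,+),((ω₀^{(M_i)},k⃗),σ,−))·χ_{k⃗}(y)` — the cutoff dependence of `ε_i = β/(2M_i)`
and of the time grid cancels: the datum compares the position-space slices of the two momentum two-leg kernels at the common physical frequency `±π/β`.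
Proofs only; no definitions; nothing about the model is asserted beyond the displayed inequalities.  References: BGM 2006 §2.1 (2.4)–(2.5), §2.4 (2.36)
[cite: BenfattoGiulianiMastropietro2006].
-/

noncomputable section

namespace Summit.HubbardSuperconductivity.HubbardSuperconductivity.Theorems.TwoVolumeDefect

set_option linter.dupNamespace false -- summit = problem name (single-conjunct summit), D-0017

open Finset Complex Literature.MathematicalPhysics.QuantumLattice Literature.Probability.LatticeModels GrassmannAlgebra
open Summit.HubbardSuperconductivity.HubbardSuperconductivity.Theorems.KLRegimeSplit
open Summit.HubbardSuperconductivity.HubbardSuperconductivity.Theorems.KLProgrammeLegKernels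
open Summit.HubbardSuperconductivity.HubbardSuperconductivity.Theorems.TwoLegFourier
open scoped ComplexConjugate

/-! ## §1 One torus, two cutoffs: the common-point symInterp difference from the difference of the `ε`-weighted rows -/

section TwoCutoffs

variable {L M₁ M₂ : ℕ} [NeZero L] [NeZero M₁] [NeZero M₂]

/-- **ONE STRING PAIR, ONE TORUS, TWO CUTOFFS, ONE COMMON POINT**: for `β ≠ 0`, Grassmann elements `G₁` (cutoff `M₁`) and `G₂` (cutoff `M₂`) with
base-point independent phase-weighted rows at the kept frequencies `ω₁`, `ω₂` and spin `σ`, any pins `o₁`, `o₂`: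
`|I_L[Re Σ_{G₁}((ω₁,·),σ)](q) − I_L[Re Σ_{G₂}((ω₂,·),σ)](q)| ≤ Σ_y (‖ε₁R₁(o₁;y) − ε₂R₂(o₂;y)‖ + ‖ε₁R₁(o₁;−y) − ε₂R₂(o₂;−y)‖)`. -/
theorem abs_eval_symInterp_re_selfEnergy_sub_le_dualCutDefect {β : ℝ} (hβ : β ≠ 0) (G₁ : HubbardGrassmann L M₁) (G₂ : HubbardGrassmann L M₂)
    (m₁ : MatsubaraIdx M₁) (m₂ : MatsubaraIdx M₂) (σ : Fin 2)
    (hrow₁ : ∀ (x₀ x₀' : SpaceTimeIdx L M₁) (z : TorusSite 2 L),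
      (∑ t₁ : ImagTimeIdx M₁,
        sectorisedKernel L M₁ β (trivialMultiplier L M₁) G₁ 2 (![((0, σ), 0), ((0, σ), 1)] : Fin 2 → SectorLeg 1) ![x₀, (t₁, x₀.2 + z)] *
          Complex.exp (((matsubaraFreq β M₁ m₁ * (imagTime β M₁ x₀.1 - imagTime β M₁ t₁) : ℝ) : ℂ) * I)) =
      ∑ t₁ : ImagTimeIdx M₁,
        sectorisedKernel L M₁ β (trivialMultiplier L M₁) G₁ 2 (![((0, σ), 0), ((0, σ), 1)] : Fin 2 → SectorLeg 1) ![x₀', (t₁, x₀'.2 + z)] *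
          Complex.exp (((matsubaraFreq β M₁ m₁ * (imagTime β M₁ x₀'.1 - imagTime β M₁ t₁) : ℝ) : ℂ) * I))
    (hrow₂ : ∀ (x₀ x₀' : SpaceTimeIdx L M₂) (z : TorusSite 2 L),
      (∑ t₁ : ImagTimeIdx M₂,
        sectorisedKernel L M₂ β (trivialMultiplier L M₂) G₂ 2 (![((0, σ), 0), ((0, σ), 1)] : Fin 2 → SectorLeg 1) ![x₀, (t₁, x₀.2 + z)] *
          Complex.exp (((matsubaraFreq β M₂ m₂ * (imagTime β M₂ x₀.1 - imagTime β M₂ t₁) : ℝ) : ℂ) * I)) =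
      ∑ t₁ : ImagTimeIdx M₂,
        sectorisedKernel L M₂ β (trivialMultiplier L M₂) G₂ 2 (![((0, σ), 0), ((0, σ), 1)] : Fin 2 → SectorLeg 1) ![x₀', (t₁, x₀'.2 + z)] *
          Complex.exp (((matsubaraFreq β M₂ m₂ * (imagTime β M₂ x₀'.1 - imagTime β M₂ t₁) : ℝ) : ℂ) * I))
    (o₁ : SpaceTimeIdx L M₁) (o₂ : SpaceTimeIdx L M₂) {D : ℝ}
    (hD : ∑ y : TorusSite 2 L,
      (‖(imagTimeWeight β M₁ : ℂ) * (∑ t₁ : ImagTimeIdx M₁,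
          sectorisedKernel L M₁ β (trivialMultiplier L M₁) G₁ 2 (![((0, σ), 0), ((0, σ), 1)] : Fin 2 → SectorLeg 1) ![o₁, (t₁, o₁.2 + y)] *
            Complex.exp (((matsubaraFreq β M₁ m₁ * (imagTime β M₁ o₁.1 - imagTime β M₁ t₁) : ℝ) : ℂ) * I)) -
        (imagTimeWeight β M₂ : ℂ) * (∑ t₁ : ImagTimeIdx M₂,
          sectorisedKernel L M₂ β (trivialMultiplier L M₂) G₂ 2 (![((0, σ), 0), ((0, σ), 1)] : Fin 2 → SectorLeg 1) ![o₂, (t₁, o₂.2 + y)] *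
            Complex.exp (((matsubaraFreq β M₂ m₂ * (imagTime β M₂ o₂.1 - imagTime β M₂ t₁) : ℝ) : ℂ) * I))‖ +
      ‖(imagTimeWeight β M₁ : ℂ) * (∑ t₁ : ImagTimeIdx M₁,
          sectorisedKernel L M₁ β (trivialMultiplier L M₁) G₁ 2 (![((0, σ), 0), ((0, σ), 1)] : Fin 2 → SectorLeg 1) ![o₁, (t₁, o₁.2 + -y)] *
            Complex.exp (((matsubaraFreq β M₁ m₁ * (imagTime β M₁ o₁.1 - imagTime β M₁ t₁) : ℝ) : ℂ) * I)) -
        (imagTimeWeight β M₂ : ℂ) * (∑ t₁ : ImagTimeIdx M₂,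
          sectorisedKernel L M₂ β (trivialMultiplier L M₂) G₂ 2 (![((0, σ), 0), ((0, σ), 1)] : Fin 2 → SectorLeg 1) ![o₂, (t₁, o₂.2 + -y)] *
            Complex.exp (((matsubaraFreq β M₂ m₂ * (imagTime β M₂ o₂.1 - imagTime β M₂ t₁) : ℝ) : ℂ) * I))‖) ≤ D)
    (q : Fin 2 → ℝ) :
    |(symInterp L (fun k => (selfEnergy L M₁ β G₁ (m₁, k) σ).re)).eval q -
        (symInterp L (fun k => (selfEnergy L M₂ β G₂ (m₂, k) σ).re)).eval q| ≤ D := by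
  rw [← eval_symInterp_sub]
  refine (abs_symInterp_eval_le _ q).trans (le_trans (sum_le_sum fun y _ => ?_) hD)
  rw [torusCosCoeff_sub, torusCosCoeff_re_selfEnergy_eq_row_of_rowInvariant hβ G₁ m₁ σ hrow₁ o₁ y,
    torusCosCoeff_re_selfEnergy_eq_row_of_rowInvariant hβ G₂ m₂ σ hrow₂ o₂ y, ← Complex.re_ofReal_mul, ← Complex.re_ofReal_mul,
    ← Complex.sub_re]
  refine (Complex.abs_re_le_norm _).trans ?_
  rw [mul_add, mul_add, add_sub_add_comm]
  exact norm_add_le _ _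

end TwoCutoffs

/-! ## §2 The model at scale `n`: one torus, two cutoffs, two frames -/

section Model

variable {L M₁ M₂ : ℕ} [NeZero L] [NeZero M₁] [NeZero M₂]

/-- **(D) OF THE CUTOFF-LEG SPLIT DOOR FROM THE DUAL-LATTICE ROWS**, every scale `n`, two frames: torus `L`, cutoffs `M₁`, `M₂`, `0 < β`, frames
`K₁`, `K₂` of degree `≤ L/2`, separated data `G_i = klEffectiveAction L M_i β U μ K_i klE0 n − counterQuadratic L M_i β K_i`, pins `o₁`, `o₂`; if
for each spin `σ` and each of the two string pairs (`ω₀^{(M₁)} ↔ ω₀^{(M₂)}` and their reverses) the `ε`-weighted rows satisfy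
`Σ_y (‖ε₁R₁(o₁;y) − ε₂R₂(o₂;y)‖ + ‖ε₁R₁(o₁;−y) − ε₂R₂(o₂;−y)‖) ≤ D`, then at every continuum point `q`
`|S₁(q) − S₂(q)| ≤ |K₁(q) − K₂(q)| + D`, `S_i = symInterp L (klLocSelfEnergyRe L M_i β U μ K_i n)`. -/
theorem abs_symInterp_locRe_sub_le_frame_add_dualCutDefect {β : ℝ} (hβ : 0 < β) (U μ : ℝ) {K₁ K₂ : TrigPolyC4v}
    (hdeg₁ : K₁.degree ≤ L / 2) (hdeg₂ : K₂.degree ≤ L / 2) (n : ℕ) (o₁ : SpaceTimeIdx L M₁) (o₂ : SpaceTimeIdx L M₂) {D : ℝ}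
    (hDp : ∀ σ : Fin 2, ∑ y : TorusSite 2 L,
      (‖(imagTimeWeight β M₁ : ℂ) * (∑ t₁ : ImagTimeIdx M₁,
          sectorisedKernel L M₁ β (trivialMultiplier L M₁) (klEffectiveAction L M₁ β U μ K₁ klE0 n - counterQuadratic L M₁ β K₁) 2
              (![((0, σ), 0), ((0, σ), 1)] : Fin 2 → SectorLeg 1) ![o₁, (t₁, o₁.2 + y)] *
            Complex.exp (((matsubaraFreq β M₁ (omega0 M₁) * (imagTime β M₁ o₁.1 - imagTime β M₁ t₁) : ℝ) : ℂ) * I)) -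
        (imagTimeWeight β M₂ : ℂ) * (∑ t₁ : ImagTimeIdx M₂,
          sectorisedKernel L M₂ β (trivialMultiplier L M₂) (klEffectiveAction L M₂ β U μ K₂ klE0 n - counterQuadratic L M₂ β K₂) 2
              (![((0, σ), 0), ((0, σ), 1)] : Fin 2 → SectorLeg 1) ![o₂, (t₁, o₂.2 + y)] *
            Complex.exp (((matsubaraFreq β M₂ (omega0 M₂) * (imagTime β M₂ o₂.1 - imagTime β M₂ t₁) : ℝ) : ℂ) * I))‖ +
      ‖(imagTimeWeight β M₁ : ℂ) * (∑ t₁ : ImagTimeIdx M₁,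
          sectorisedKernel L M₁ β (trivialMultiplier L M₁) (klEffectiveAction L M₁ β U μ K₁ klE0 n - counterQuadratic L M₁ β K₁) 2
              (![((0, σ), 0), ((0, σ), 1)] : Fin 2 → SectorLeg 1) ![o₁, (t₁, o₁.2 + -y)] *
            Complex.exp (((matsubaraFreq β M₁ (omega0 M₁) * (imagTime β M₁ o₁.1 - imagTime β M₁ t₁) : ℝ) : ℂ) * I)) -
        (imagTimeWeight β M₂ : ℂ) * (∑ t₁ : ImagTimeIdx M₂,
          sectorisedKernel L M₂ β (trivialMultiplier L M₂) (klEffectiveAction L M₂ β U μ K₂ klE0 n - counterQuadratic L M₂ β K₂) 2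
              (![((0, σ), 0), ((0, σ), 1)] : Fin 2 → SectorLeg 1) ![o₂, (t₁, o₂.2 + -y)] *
            Complex.exp (((matsubaraFreq β M₂ (omega0 M₂) * (imagTime β M₂ o₂.1 - imagTime β M₂ t₁) : ℝ) : ℂ) * I))‖) ≤ D)
    (hDm : ∀ σ : Fin 2, ∑ y : TorusSite 2 L,
      (‖(imagTimeWeight β M₁ : ℂ) * (∑ t₁ : ImagTimeIdx M₁,
          sectorisedKernel L M₁ β (trivialMultiplier L M₁) (klEffectiveAction L M₁ β U μ K₁ klE0 n - counterQuadratic L M₁ β K₁) 2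
              (![((0, σ), 0), ((0, σ), 1)] : Fin 2 → SectorLeg 1) ![o₁, (t₁, o₁.2 + y)] *
            Complex.exp (((matsubaraFreq β M₁ (omega0 M₁).rev * (imagTime β M₁ o₁.1 - imagTime β M₁ t₁) : ℝ) : ℂ) * I)) -
        (imagTimeWeight β M₂ : ℂ) * (∑ t₁ : ImagTimeIdx M₂,
          sectorisedKernel L M₂ β (trivialMultiplier L M₂) (klEffectiveAction L M₂ β U μ K₂ klE0 n - counterQuadratic L M₂ β K₂) 2
              (![((0, σ), 0), ((0, σ), 1)] : Fin 2 → SectorLeg 1) ![o₂, (t₁, o₂.2 + y)] *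
            Complex.exp (((matsubaraFreq β M₂ (omega0 M₂).rev * (imagTime β M₂ o₂.1 - imagTime β M₂ t₁) : ℝ) : ℂ) * I))‖ +
      ‖(imagTimeWeight β M₁ : ℂ) * (∑ t₁ : ImagTimeIdx M₁,
          sectorisedKernel L M₁ β (trivialMultiplier L M₁) (klEffectiveAction L M₁ β U μ K₁ klE0 n - counterQuadratic L M₁ β K₁) 2
              (![((0, σ), 0), ((0, σ), 1)] : Fin 2 → SectorLeg 1) ![o₁, (t₁, o₁.2 + -y)] *
            Complex.exp (((matsubaraFreq β M₁ (omega0 M₁).rev * (imagTime β M₁ o₁.1 - imagTime β M₁ t₁) : ℝ) : ℂ) * I)) -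
        (imagTimeWeight β M₂ : ℂ) * (∑ t₁ : ImagTimeIdx M₂,
          sectorisedKernel L M₂ β (trivialMultiplier L M₂) (klEffectiveAction L M₂ β U μ K₂ klE0 n - counterQuadratic L M₂ β K₂) 2
              (![((0, σ), 0), ((0, σ), 1)] : Fin 2 → SectorLeg 1) ![o₂, (t₁, o₂.2 + -y)] *
            Complex.exp (((matsubaraFreq β M₂ (omega0 M₂).rev * (imagTime β M₂ o₂.1 - imagTime β M₂ t₁) : ℝ) : ℂ) * I))‖) ≤ D)
    (q : Fin 2 → ℝ) :
    |(symInterp L (klLocSelfEnergyRe L M₁ β U μ K₁ n)).eval q - (symInterp L (klLocSelfEnergyRe L M₂ β U μ K₂ n)).eval q| ≤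
      |K₁.eval q - K₂.eval q| + D := by
  set G₁ := klEffectiveAction L M₁ β U μ K₁ klE0 n - counterQuadratic L M₁ β K₁ with hG₁
  set G₂ := klEffectiveAction L M₂ β U μ K₂ klE0 n - counterQuadratic L M₂ β K₂ with hG₂
  -- the reading = frame + interpolant of the separated data, at `q`
  have hsplit : ∀ (M : ℕ) [NeZero M] (K : TrigPolyC4v), K.degree ≤ L / 2 →
      (symInterp L (klLocSelfEnergyRe L M β U μ K n)).eval q =
        (symInterp L (fun p => klLocSelfEnergyRe L M β U μ K n p - K.eval (latticeMomentum L p))).eval q + K.eval q := by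
    intro M _ K hdeg
    have h := congrFun (evalM_symInterp_eq_sep_add_frame (L := L) (M := M) hdeg β U μ n) (WithLp.toLp 2 q)
    simpa only [evalM_apply, WithLp.ofLp_toLp] using h
  have hsep : ∀ (M : ℕ) [NeZero M] (K : TrigPolyC4v),
      (fun p => klLocSelfEnergyRe L M β U μ K n p - K.eval (latticeMomentum L p)) = fun p => (1 / 4 : ℝ) *
        ((((selfEnergy L M β (klEffectiveAction L M β U μ K klE0 n - counterQuadratic L M β K) (omega0 M, p) 0).re +
          (selfEnergy L M β (klEffectiveAction L M β U μ K klE0 n - counterQuadratic L M β K) ((omega0 M).rev, p) 0).re) +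
         ((selfEnergy L M β (klEffectiveAction L M β U μ K klE0 n - counterQuadratic L M β K) (omega0 M, p) 1).re +
          (selfEnergy L M β (klEffectiveAction L M β U μ K klE0 n - counterQuadratic L M β K) ((omega0 M).rev, p) 1).re))) := by
    intro M _ K
    funext p
    rw [klLocSelfEnergyRe_sub_frame_eq_locRe hβ.ne' U μ K n p, Fin.sum_univ_two]
    ring
  have heval : ∀ (M : ℕ) [NeZero M] (K : TrigPolyC4v),
      (symInterp L (fun p => klLocSelfEnergyRe L M β U μ K n p - K.eval (latticeMomentum L p))).eval q = (1 / 4 : ℝ) *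
        ((((symInterp L (fun p => (selfEnergy L M β (klEffectiveAction L M β U μ K klE0 n - counterQuadratic L M β K) (omega0 M, p) 0).re)).eval q +
          (symInterp L (fun p => (selfEnergy L M β (klEffectiveAction L M β U μ K klE0 n - counterQuadratic L M β K) ((omega0 M).rev, p) 0).re)).eval q) +
         ((symInterp L (fun p => (selfEnergy L M β (klEffectiveAction L M β U μ K klE0 n - counterQuadratic L M β K) (omega0 M, p) 1).re)).eval q +
          (symInterp L (fun p => (selfEnergy L M β (klEffectiveAction L M β U μ K klE0 n - counterQuadratic L M β K) ((omega0 M).rev, p) 1).re)).eval q))) := by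
    intro M _ K
    rw [hsep M K, eval_symInterp_const_mul, eval_symInterp_add, eval_symInterp_add, eval_symInterp_add]
  -- the four string pairs, each through §1 (rows base-point free for the model)
  have hstrp : ∀ σ : Fin 2,
      |(symInterp L (fun k => (selfEnergy L M₁ β G₁ (omega0 M₁, k) σ).re)).eval q -
        (symInterp L (fun k => (selfEnergy L M₂ β G₂ (omega0 M₂, k) σ).re)).eval q| ≤ D := fun σ =>
    abs_eval_symInterp_re_selfEnergy_sub_le_dualCutDefect hβ.ne' G₁ G₂ (omega0 M₁) (omega0 M₂) σ
      (fun x₀ x₀' z => rows_baseIndependent_klEffectiveAction_sub_counter hβ.ne' U μ K₁ n (omega0 M₁) σ x₀ x₀' z)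
      (fun x₀ x₀' z => rows_baseIndependent_klEffectiveAction_sub_counter hβ.ne' U μ K₂ n (omega0 M₂) σ x₀ x₀' z) o₁ o₂ (hDp σ) q
  have hstrm : ∀ σ : Fin 2,
      |(symInterp L (fun k => (selfEnergy L M₁ β G₁ ((omega0 M₁).rev, k) σ).re)).eval q -
        (symInterp L (fun k => (selfEnergy L M₂ β G₂ ((omega0 M₂).rev, k) σ).re)).eval q| ≤ D := fun σ =>
    abs_eval_symInterp_re_selfEnergy_sub_le_dualCutDefect hβ.ne' G₁ G₂ (omega0 M₁).rev (omega0 M₂).rev σ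
      (fun x₀ x₀' z => rows_baseIndependent_klEffectiveAction_sub_counter hβ.ne' U μ K₁ n (omega0 M₁).rev σ x₀ x₀' z)
      (fun x₀ x₀' z => rows_baseIndependent_klEffectiveAction_sub_counter hβ.ne' U μ K₂ n (omega0 M₂).rev σ x₀ x₀' z) o₁ o₂ (hDm σ) q
  have h00 := hstrp 0
  have h01 := hstrm 0
  have h10 := hstrp 1
  have h11 := hstrm 1
  rw [hsplit M₁ K₁ hdeg₁, hsplit M₂ K₂ hdeg₂, heval M₁ K₁, heval M₂ K₂]
  rw [abs_sub_comm] at h00 h01 h10 h11 ⊢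
  have habs : ∀ (a₁ a₂ a₃ a₄ c₁ c₂ c₃ c₄ kc kf : ℝ),
      |(1 / 4 : ℝ) * ((c₁ + c₂) + (c₃ + c₄)) + kf - ((1 / 4 : ℝ) * ((a₁ + a₂) + (a₃ + a₄)) + kc)| ≤
        |kc - kf| + (1 / 4 : ℝ) * (|c₁ - a₁| + |c₂ - a₂| + |c₃ - a₃| + |c₄ - a₄|) := by
    intro a₁ a₂ a₃ a₄ c₁ c₂ c₃ c₄ kc kf
    have h : (1 / 4 : ℝ) * ((c₁ + c₂) + (c₃ + c₄)) + kf - ((1 / 4 : ℝ) * ((a₁ + a₂) + (a₃ + a₄)) + kc) =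
        (kf - kc) + (1 / 4 : ℝ) * ((c₁ - a₁) + (c₂ - a₂) + (c₃ - a₃) + (c₄ - a₄)) := by ring
    rw [h]
    refine (abs_add_le _ _).trans ?_
    rw [abs_sub_comm kf kc, abs_mul, abs_of_pos (by norm_num : (0 : ℝ) < 1 / 4)]
    gcongr
    exact (abs_add_le _ _).trans (add_le_add ((abs_add_le _ _).trans (add_le_add (abs_add_le _ _) le_rfl)) le_rfl)
  refine (habs _ _ _ _ _ _ _ _ _ _).trans ?_
  have hsum : (1 / 4 : ℝ) * (D + D + D + D) = D := by ring
  rw [← hsum]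
  gcongr

end Model

end Summit.HubbardSuperconductivity.HubbardSuperconductivity.Theorems.TwoVolumeDefect

end
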